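import Mathlib
import HarnessLib

/-!
# Route LiouvilleSarnak — support `AlignedTypeI` (stmt-ValiantsHypothesis-21040), line `characters_mod_2n`:
# block maps for the bilinear inequality — fibre sums from cumulative sums

`…BilinearSieve.lean` (`charSqSum_mul_sq_le_of_blockBounds`) consumes a block map `V` on a set of primes `𝒫` (`p ≤ V p`,
`x·V p ≤ x·p + ℓ·V p`) and bounds `β_v ≥ |Σ_{p ∈ 𝒫, V p = v} ψ(p)|` on its fibres.  The analytic input in print (prime
character sums to `2`-power moduli: Gallagher 1972; Banks–Shparlinski 2019, Thm 2.2) bounds CUMULATIVE sums `Σ_{p ≤ u} ψ(p)`.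
This file is the combinatorial bridge, def-free and for arbitrary coefficients `c : ℕ → ℂ`: for a CEILING block map
(`p ≤ V p`, and `V p ≤ v` whenever `p ≤ v` for a block value `v` — e.g. "round `p` up into a fixed set of admissible
endpoints", in particular the binary rounding `2^i ⌈p/2^i⌉`, `i = ⌊log₂ p⌋ − s`), every fibre is a difference of two
cumulative sums over `𝒫` (`sum_fibre_eq_sub_of_ceiling`), hence `|Σ_{p ∈ 𝒫, V p = v} c(p)| ≤ 2F(v)` as soon as
`|Σ_{p ∈ 𝒫, p ≤ t} c(p)| ≤ F(t)` for `t ∈ 𝒫 ∪ {v}`, `t ≤ v`, with `F` monotone (`norm_sum_fibre_le_of_ceiling`); and the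
cumulative sums over `𝒫 = {primes in (a, b]}` are differences of the full prime sums `Σ_{p ≤ u} c(p)`
(`sum_primes_Ioc_filter_le_eq_sub`).

HONEST FRAMING. Bookkeeping only; `AlignedTypeI` is NOT closed here; nothing bears on `VP ≠ VNP` (NOT proved).
-/

set_option linter.dupNamespace false

noncomputable section

namespace Summit.ValiantsHypothesis.ValiantsHypothesis.Theorems.LiouvilleSarnak.AlignedTypeI.CharactersModTwoN

open Finset
open scoped BigOperators

/-! ## §1 Fibre sums of a ceiling block map from cumulative sums -/

/-- **Fibres of a ceiling block map.**  If `p ≤ V p` on `P` and `V p ≤ v` for all `p ∈ P` with `p ≤ v`, then the fibre of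
`v` is `{p ∈ P : p ≤ v} \ {p ∈ P : V p < v}`, so that
`Σ_{p ∈ P, V p = v} c(p) = Σ_{p ∈ P, p ≤ v} c(p) − Σ_{p ∈ P, V p < v} c(p)`. [folklore] -/
theorem sum_fibre_eq_sub_of_ceiling (P : Finset ℕ) (V : ℕ → ℕ) (hle : ∀ p ∈ P, p ≤ V p) (v : ℕ)
    (hceil : ∀ p ∈ P, p ≤ v → V p ≤ v) (c : ℕ → ℂ) :
    ∑ p ∈ P.filter (fun p => V p = v), c p =
      ∑ p ∈ P.filter (fun p => p ≤ v), c p - ∑ p ∈ P.filter (fun p => V p < v), c p := by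
  classical
  have hsub : P.filter (fun p => V p < v) ⊆ P.filter (fun p => p ≤ v) := by
    intro p hp
    rw [Finset.mem_filter] at hp ⊢
    exact ⟨hp.1, (hle p hp.1).trans hp.2.le⟩
  have hfib : P.filter (fun p => V p = v) = P.filter (fun p => p ≤ v) \ P.filter (fun p => V p < v) := by
    ext p
    simp only [Finset.mem_sdiff, Finset.mem_filter, not_and, not_lt]
    constructor
    · rintro ⟨hp, hv⟩
      exact ⟨⟨hp, hv ▸ hle p hp⟩, fun _ => hv.symm.le⟩
    · rintro ⟨⟨hp, hpv⟩, h⟩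
      exact ⟨hp, le_antisymm (hceil p hp hpv) (h hp)⟩
  rw [hfib, Finset.sum_sdiff_eq_sub hsub]

/-- The primes of `P` sent strictly below `v` by a ceiling block map form an initial segment of `P`: either there are
none, or they are exactly `{p ∈ P : p ≤ t}` for `t` the largest of them (and `t < v`). [folklore] -/
theorem filter_lt_eq_filter_le_max (P : Finset ℕ) (V : ℕ → ℕ)
    (hmono : ∀ p ∈ P, ∀ p' ∈ P, p ≤ p' → V p ≤ V p') (v : ℕ)
    (hne : (P.filter (fun p => V p < v)).Nonempty) :
    P.filter (fun p => V p < v) =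
      P.filter (fun p => p ≤ (P.filter (fun p => V p < v)).max' hne) := by
  classical
  set D := P.filter (fun p => V p < v) with hD
  have htD : D.max' hne ∈ D := Finset.max'_mem D hne
  have ht : D.max' hne ∈ P ∧ V (D.max' hne) < v := by
    simpa only [hD, Finset.mem_filter] using htD
  ext p
  simp only [Finset.mem_filter]
  constructor
  · rintro ⟨hp, hpv⟩
    exact ⟨hp, Finset.le_max' D p (by rw [hD, Finset.mem_filter]; exact ⟨hp, hpv⟩)⟩
  · rintro ⟨hp, hpt⟩
    exact ⟨hp, lt_of_le_of_lt (hmono p hp _ ht.1 hpt) ht.2⟩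

/-- **Fibre sums from cumulative sums.**  Let `V` be a monotone ceiling block map on `P` (`p ≤ V p`; `V p ≤ v` when
`p ≤ v`), `c : ℕ → ℂ`, `F : ℕ → ℝ` monotone with `|Σ_{p ∈ P, p ≤ t} c(p)| ≤ F(t)` for all `t ∈ P` with `t ≤ v` and for
`t = v`.  Then `|Σ_{p ∈ P, V p = v} c(p)| ≤ 2 F(v)`. [folklore] -/
theorem norm_sum_fibre_le_of_ceiling (P : Finset ℕ) (V : ℕ → ℕ)
    (hmono : ∀ p ∈ P, ∀ p' ∈ P, p ≤ p' → V p ≤ V p') (hle : ∀ p ∈ P, p ≤ V p) (v : ℕ)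
    (hceil : ∀ p ∈ P, p ≤ v → V p ≤ v) (c : ℕ → ℂ) (F : ℕ → ℝ) (hF : Monotone F)
    (hFv : ‖∑ p ∈ P.filter (fun p => p ≤ v), c p‖ ≤ F v)
    (hFt : ∀ t ∈ P, t ≤ v → ‖∑ p ∈ P.filter (fun p => p ≤ t), c p‖ ≤ F t) :
    ‖∑ p ∈ P.filter (fun p => V p = v), c p‖ ≤ 2 * F v := by
  classical
  have hF0 : 0 ≤ F v := le_trans (norm_nonneg _) hFv
  rw [sum_fibre_eq_sub_of_ceiling P V hle v hceil c]
  refine (norm_sub_le _ _).trans ?_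
  have hD : ‖∑ p ∈ P.filter (fun p => V p < v), c p‖ ≤ F v := by
    by_cases hne : (P.filter (fun p => V p < v)).Nonempty
    · rw [filter_lt_eq_filter_le_max P V hmono v hne]
      set t := (P.filter (fun p => V p < v)).max' hne with ht
      have htD : t ∈ P.filter (fun p => V p < v) := Finset.max'_mem _ hne
      rw [Finset.mem_filter] at htD
      have htv : t ≤ v := (hle t htD.1).trans htD.2.le
      exact (hFt t htD.1 htv).trans (hF htv)
    · rw [Finset.not_nonempty_iff_eq_empty] at hne
      rw [hne, Finset.sum_empty, norm_zero]
      exact hF0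
  linarith

/-! ## §2 Cumulative sums over the primes of `(a, b]` -/

/-- For `P = {primes in (a, b]}`, `a ≤ b`, `a ≤ t`:
`Σ_{p ∈ P, p ≤ t} c(p) = Σ_{p ≤ min t b, p prime} c(p) − Σ_{p ≤ a, p prime} c(p)`. [folklore] -/
theorem sum_primes_Ioc_filter_le_eq_sub (a b t : ℕ) (hab : a ≤ b) (hat : a ≤ t) (c : ℕ → ℂ) :
    ∑ p ∈ ((Finset.Ioc a b).filter Nat.Prime).filter (fun p => p ≤ t), c p =
      ∑ p ∈ (Finset.Iic (min t b)).filter Nat.Prime, c p - ∑ p ∈ (Finset.Iic a).filter Nat.Prime, c p := by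
  have hsub : (Finset.Iic a).filter Nat.Prime ⊆ (Finset.Iic (min t b)).filter Nat.Prime := by
    intro p hp
    simp only [Finset.mem_filter, Finset.mem_Iic] at hp ⊢
    exact ⟨le_min (hp.1.trans hat) (hp.1.trans hab), hp.2⟩
  rw [← Finset.sum_sdiff_eq_sub hsub]
  congr 1
  ext p
  simp only [Finset.mem_sdiff, Finset.mem_filter, Finset.mem_Ioc, Finset.mem_Iic, le_min_iff, not_and]
  constructor
  · rintro ⟨⟨⟨hap, hpb⟩, hp⟩, hpt⟩
    exact ⟨⟨⟨hpt, hpb⟩, hp⟩, fun h => absurd hap (not_lt.mpr h)⟩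
  · rintro ⟨⟨⟨hpt, hpb⟩, hp⟩, h⟩
    refine ⟨⟨⟨?_, hpb⟩, hp⟩, hpt⟩
    by_contra hpa
    exact h (not_lt.mp hpa) hp

/-- **Cumulative sums over `{primes in (a, b]}` from full prime sums.**  If `|Σ_{p ≤ u, p prime} c(p)| ≤ G(u)` for all
`u ≥ a`, with `G` monotone, then `|Σ_{p ∈ P, p ≤ t} c(p)| ≤ 2 G(t)` for `P = {primes in (a, b]}`, `a ≤ b`, `a ≤ t`. [folklore] -/
theorem norm_sum_primes_Ioc_filter_le (a b t : ℕ) (hab : a ≤ b) (hat : a ≤ t) (c : ℕ → ℂ) (G : ℕ → ℝ)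
    (hG : Monotone G) (hcum : ∀ u, a ≤ u → ‖∑ p ∈ (Finset.Iic u).filter Nat.Prime, c p‖ ≤ G u) :
    ‖∑ p ∈ ((Finset.Ioc a b).filter Nat.Prime).filter (fun p => p ≤ t), c p‖ ≤ 2 * G t := by
  rw [sum_primes_Ioc_filter_le_eq_sub a b t hab hat c]
  refine (norm_sub_le _ _).trans ?_
  have h1 : ‖∑ p ∈ (Finset.Iic (min t b)).filter Nat.Prime, c p‖ ≤ G t :=
    (hcum (min t b) (le_min hat hab)).trans (hG (min_le_left t b))
  have h2 : ‖∑ p ∈ (Finset.Iic a).filter Nat.Prime, c p‖ ≤ G t := (hcum a le_rfl).trans (hG hat)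
  linarith

/-- **Block bounds from prime-sum bounds** (the two bridges composed).  `P = {primes in (a, b]}` (`a ≤ b`), `V` a monotone
ceiling block map on `P`, `v ≥ a` a block value, `G` monotone with `|Σ_{p ≤ u, p prime} c(p)| ≤ G(u)` for `u ≥ a`:
then `|Σ_{p ∈ P, V p = v} c(p)| ≤ 4 G(v)`. [folklore] -/
theorem norm_sum_fibre_le_of_primeSums (a b : ℕ) (hab : a ≤ b) (V : ℕ → ℕ)
    (hmono : ∀ p ∈ (Finset.Ioc a b).filter Nat.Prime, ∀ p' ∈ (Finset.Ioc a b).filter Nat.Prime, p ≤ p' → V p ≤ V p')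
    (hle : ∀ p ∈ (Finset.Ioc a b).filter Nat.Prime, p ≤ V p) (v : ℕ) (hav : a ≤ v)
    (hceil : ∀ p ∈ (Finset.Ioc a b).filter Nat.Prime, p ≤ v → V p ≤ v) (c : ℕ → ℂ) (G : ℕ → ℝ)
    (hG : Monotone G) (hcum : ∀ u, a ≤ u → ‖∑ p ∈ (Finset.Iic u).filter Nat.Prime, c p‖ ≤ G u) :
    ‖∑ p ∈ ((Finset.Ioc a b).filter Nat.Prime).filter (fun p => V p = v), c p‖ ≤ 4 * G v := by
  have h := norm_sum_fibre_le_of_ceiling ((Finset.Ioc a b).filter Nat.Prime) V hmono hle v hceil c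
    (fun t => 2 * G t) (fun x y hxy => by have := hG hxy; linarith)
    (norm_sum_primes_Ioc_filter_le a b v hab hav c G hG hcum)
    (fun t ht _ => norm_sum_primes_Ioc_filter_le a b t hab
      (by simp only [Finset.mem_filter, Finset.mem_Ioc] at ht; exact ht.1.1.le) c G hG hcum)
  linarith

end Summit.ValiantsHypothesis.ValiantsHypothesis.Theorems.LiouvilleSarnak.AlignedTypeI.CharactersModTwoN
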